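import Literature.NumberTheory.EllipticCurves.PotentialGoodReductionOddProofs
import Literature.NumberTheory.EllipticCurves.NeronOggShafarevichLocalProofs
import Literature.NumberTheory.EllipticCurves.NeronOggShafarevichProofs
import Literature.NumberTheory.EllipticCurves.SwanConductorTorsionProofs
import Literature.NumberTheory.EllipticCurves.HasseWeilAbelianPotentialGoodReductionProofs
import Literature.NumberTheory.EllipticCurves.HasseWeilAbelianTameIntegralJProofs
import Literature.NumberTheory.GaloisRepresentations.ArtinRestriction
import Literature.NumberTheory.GaloisRepresentations.AbsIntegersEquiv
import HarnessLib

/-!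
# The kernel of the wild inertia action on `T_ℓ E` does not depend on `ℓ`
# (Serre–Tate 1968 §1–2; Silverman *ATAEC* Prop. IV.10.3, proof of Thm. IV.10.2(b)), proofs

`Proofs` file (theorems only: no definitions, no named facts, no instances) in topic
`NumberTheory/EllipticCurves`, landed by the tenured seat of the named fact
`Literature.NumberTheory.Automorphic.BCDT.CDT_theorem_7_2_4` (Conrad–Diamond–Taylor 1999,
Thm. 7.2.4) as a bottom-up step under the one Galois-side input of the printed proof of that
theorem which is not a modularity statement: Ogg's formula at the place `3` (CDT, *JAMS* 12 (1999),
p. 556: *"Since `ρ̄_{E',5} ≅ ρ̄_{E,5}`, the conductor of `E'` is not divisible by `27`"*, and the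
Introduction, p. 522: `27 ∤ N_E` *"if and only if `E` acquires semistable reduction over a tamely
ramified extension of `ℚ₃`"*).  In the tree that input is the named fact
`WeierstrassCurve.swanConductorAt_rationalTate_eq_wildConductorExponent_of_ringChar_eq_three W 5`
(`HasseWeilAbelianConductorOggSaito`; used by `CDTTheorem712OggThreeProofs`), i.e. Ogg's formula
for the wild conductor of the **`5`-adic** Tate module at the additive places of residue
characteristic `3`.  The held source for Ogg's formula (Silverman, *Advanced Topics in the
Arithmetic of Elliptic Curves*, proof of Thm. IV.11.1 for `p = 3`, PDF pp. 366–371) computes the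
wild conductor of `E[2]` (`L = K(E[2])`), i.e. proves the `ℓ = 2` instance, and transfers it to
other `ℓ` by Thm. IV.10.2(c), whose general case the book does **not** prove (PDF p. 362: *"The
general case, which is due to Ogg [2], uses more machinery than we want to develop here"*).

CDT's two uses of Ogg's formula at `3` (the conductor step and the hidden lemma of Thm. 7.2.4) only
need it in *zero form*: `δ₃(E) = 0 ↔ V₅ E` is tame above `3`.  In zero form the transfer from
`ℓ = 2` to `ℓ = 5` does not need Thm. IV.10.2(c) but only the following theorem, proved in this
file at the places of potentially good reduction (and completed at the places of potentially
multiplicative reduction of odd residue characteristic in the sibling files of this seat):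

**Theorem (Serre–Tate).**  Let `E/K` be an elliptic curve over a number field, `v` a finite place,
`𝔓 ∣ v` a prime of `\bar ℤ_K`, and suppose `E` has potentially good reduction at `v` in Galois
form: there is a finite normal `F/K` inside `K̄` such that every element of `I_𝔓` restricting
trivially to `F` fixes the prime-to-`v` torsion of `E(K̄)` (the shape of the tree's
`exists_normal_smul_torsion_eq_self_of_valuation_j_le_one_of_notMem`,
`HasseWeilAbelianPotentialGoodReductionProofs`, which proves it at `v ∤ 6`).  Then for `τ ∈ I_𝔓`
and primes `ℓ, ℓ' ∤ v`: `τ` acts trivially on `T_ℓ E` iff it acts trivially on `T_{ℓ'} E`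
(`WeierstrassCurve.forall_smul_torsion_eq_of_forall_smul_torsion_eq_of_potentiallyGood`).  In
particular the wild ramification groups `Γ_K^u(𝔓)`, `u > 0`, act trivially on `V_ℓ E` iff they act
trivially on `V_{ℓ'} E`: **`V_ℓ E` is tame at `𝔓` iff `V_{ℓ'} E` is**
(`WeierstrassCurve.isTameAt_rationalTate_iff_of_potentiallyGood`), and `Sw_𝔓(V_ℓ E) = 0` iff
`Sw_𝔓(V_{ℓ'} E) = 0`.  With the sibling file `PotentialGoodReductionOddProofs` (potential good
reduction in Galois form at every place `v ∤ 2`, over `F ⊇ K(E[4])`) this is **unconditional at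
the places `v ∤ 2` of integral `j`** — in particular at residue characteristic `3`
(`WeierstrassCurve.isTameAt_rationalTate_iff_of_valuation_j_le_one_of_notMem_two`,
`WeierstrassCurve.swanConductorAt_rationalTate_eq_zero_iff_of_valuation_j_le_one_of_notMem_two`),
and — with the potentially multiplicative places of odd residue characteristic, where `V_ℓ E` is
tame for every `ℓ` (`isTameAt_rationalTate_of_one_lt_valuation_j`, `QuadraticTwistTateFormProofs`,
landed by the bsd.S15 seat) — at every place `v ∤ 2` and every elliptic curve (sibling file
`TateModuleTameIndependenceProofs`).

This is the content of Serre–Tate, *Good reduction of abelian varieties*, §§1–2 (for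
potential good reduction the kernel of the inertia action on `T_ℓ` is independent of `ℓ`), and of the step *"`L_{m'} ⊂ L_m` … all of the `L_m`'s are the same"* of the printed proof
of *ATAEC* Thm. IV.10.2(b) (PDF p. 361), there over `K^nr` through Prop. IV.10.3; the proof below
is that argument with the criterion of Néron–Ogg–Shafarevich (*AEC* Thm. VII.7.1, the tree's
theorems `hasGoodReductionAt_of_infinite_unramifiedTorsion_holds` /
`hasGoodReductionAt_of_infinite_unramifiedTorsion_primesAbove`) applied over the fixed field of
`⟨τ|_F⟩`:

1. (`forall_smul_torsion_eq_of_mem_inertia_inf_range`, **Lemma N**) for a finite extension `L/K`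
   with `N = image(Γ_L → Γ_K)`: if `I_𝔓 ∩ N` fixes the `ℓ`-power torsion then, over `L` at the
   place `w` under `𝔓`, every inertia group above `w` acts trivially on the `ℓ`-power torsion of
   `E_L` (transport along `E(K̄) → E_L(L̄)`, `exists_primesAbove_mem_inertia_iff`,
   `exists_pointsMapOfEmb_eq_of_nsmul_eq_zero`, conjugation over the primes above `w`), so `E_L`
   has good reduction at `w` (Néron–Ogg–Shafarevich), so `I_𝔓 ∩ N` fixes *all* prime-to-`v`
   torsion (*AEC* VII.4.1 over `L`, `smul_eq_of_mem_inertia_of_nsmul_eq_zero`, pulled back by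
   `absGaloisRestrict_smul_eq_iff`);
2. (`forall_smul_torsion_eq_of_forall_smul_torsion_eq_of_potentiallyGood`) given `τ ∈ I_𝔓` trivial
   on the `ℓ`-power torsion, apply Lemma N to the fixed field `L` of the open subgroup
   `H = {σ : σ|_F ∈ ⟨τ|_F⟩}`; the image of `Γ_L` is a conjugate `g H g⁻¹`
   (`exists_mem_range_absGaloisRestrict_fixedField_iff`), so one works at the prime `g • 𝔓`, the
   hypothesis being stable under conjugation because `F/K` is normal; `I_𝔓 ∩ H` fixes the
   `ℓ`-power torsion since `σ ∈ I_𝔓` with `σ|_F = τ|_F^k` is `(σ τ^{-k}) τ^k` with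
   `σ τ^{-k} ∈ I_𝔓 ∩ Gal(K̄/F)`.

Also proved here (used by the zero form): **`Sw_𝔓(V_ℓ E) = 0` iff `V_ℓ E` is tame at `𝔓`**
(`WeierstrassCurve.swanConductorAt_rationalTate_eq_zero_iff_isTameAt`; `⇐` is
`GaloisRep.IsTameAt.swanConductorAt_eq_zero`, `⇒` by the book's lower-numbering formula
`swanConductorAt_rationalTate_eq_finsum_torsion`: the `i = 1` term forces `G_1` of `K(E[ℓ])/K` to
fix `E[ℓ]`, and `Γ_K^u(𝔓)`, `u > 0`, restricts into `G^u ≤ G_1`), and the unconditional corollaries at the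
places `v ∤ 6` (`isTameAt_rationalTate_iff_of_notMem`, from
`exists_normal_smul_torsion_eq_self_of_valuation_j_le_one_of_notMem`; there both sides hold anyway)
and `v ∤ 2` (`…_of_notMem_two`, from `PotentialGoodReductionOddProofs`).

## References

* J.-P. Serre, J. Tate, *Good reduction of abelian varieties*, Ann. of Math. 88 (1968), §§1–3
  (not held; cited for attribution, the proofs follow *ATAEC*/*AEC*). [SerreTate1968]
* J. H. Silverman, *Advanced Topics in the Arithmetic of Elliptic Curves*, GTM 151 (1994), §IV.10:
  Prop. 10.3 and the proof of Thm. 10.2(b),(c) (PDF pp. 359–362); §IV.11, proof of Thm. 11.1 for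
  `p = 3` (pp. 366–371). [SilvermanATAEC1994]
* J. H. Silverman, *The Arithmetic of Elliptic Curves*, 2nd ed. (2009), Prop. VII.4.1,
  Thm. VII.7.1. [SilvermanAEC2009]
* B. Conrad, F. Diamond, R. Taylor, *Modularity of certain potentially Barsotti–Tate Galois
  representations*, J. Amer. Math. Soc. 12 (1999), Introduction (p. 522) and proof of Thm. 7.1.2
  (p. 556). [ConradDiamondTaylor1999]
* J.-P. Serre, *Local Fields*, GTM 67 (1979), Ch. IV §3 (upper numbering, `G^u ≤ G_1` for `u > 0`),
  Ch. VI §2 Cor. 1'. [SerreLocalFields1979]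

## Design

Theorems only; `noncomputable section`; one universe `u` (the curve, `K̄`, the intermediate
fields and their own algebraic closures all live in `Type u`, as in
`PotentialGoodReductionInertiaProofs`).  Namespaces `Literature.NumberTheory.EllipticCurves`,
`Literature.NumberTheory.GaloisRepresentations` (group-theoretic and Galois-theoretic helpers) and
`WeierstrassCurve` (deliberate dot-notation extensions next to
`smul_geomPoints_eq_of_mem_inertia_of_baseChange`, `isTameAt_rationalTate_iff_torsion`).  No
instances, no `sorry`; axioms of every theorem: `propext`, `Classical.choice`, `Quot.sound`.
-/

noncomputable section

open scoped Classical NumberField Pointwise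
open scoped AddSubgroup
open Field IsDedekindDomain

universe u

namespace Literature.NumberTheory.EllipticCurves

/-! ### Two helpers: inertia of a conjugate prime; conjugating an element trivial on torsion -/

/-- Inertia groups of conjugate primes of `\bar ℤ_K`: `σ ∈ I_{g • 𝔓} ↔ g⁻¹ σ g ∈ I_𝔓`.
Ref: Neukirch, *Algebraic Number Theory*, Ch. I §9, (9.4). [folklore] -/
theorem mem_inertia_smul_iff_conj_mem {K : Type*} [Field K] (g σ : absoluteGaloisGroup K)
    (𝔓 : Ideal (GaloisRepresentations.absIntegers (𝓞 K) K)) :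
    σ ∈ (g • 𝔓).inertia (absoluteGaloisGroup K) ↔
      g⁻¹ * σ * g ∈ 𝔓.inertia (absoluteGaloisGroup K) := by
  simp only [Ideal.inertia, AddSubgroup.mem_inertia, Submodule.mem_toAddSubgroup]
  constructor
  · intro h y
    have := Ideal.mem_pointwise_smul_iff_inv_smul_mem.mp (h (g • y))
    rwa [smul_sub, inv_smul_smul, smul_smul, smul_smul] at this
  · intro h x
    rw [Ideal.mem_pointwise_smul_iff_inv_smul_mem, smul_sub, smul_smul]
    have := h (g⁻¹ • x)
    rwa [mul_smul, mul_smul, smul_inv_smul] at this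

/-- If `τ` fixes every `m`-torsion point of a `G`-module `A` then so does every conjugate
`g τ g⁻¹` (`g⁻¹ P` is again `m`-torsion). [folklore] -/
theorem forall_smul_eq_of_nsmul_eq_zero_conj {G A : Type*} [Group G] [AddCommGroup A]
    [DistribMulAction G A] {τ : G} {m : ℕ} (h : ∀ P : A, m • P = 0 → τ • P = P) (g : G)
    (P : A) (hP : m • P = 0) : (g * τ * g⁻¹) • P = P := by
  have hQ : m • (g⁻¹ • P) = 0 := by rw [smul_comm, hP, smul_zero]
  rw [mul_smul, mul_smul, h _ hQ, smul_inv_smul]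

end Literature.NumberTheory.EllipticCurves

namespace Literature.NumberTheory.GaloisRepresentations

/-- An element of `Γ_K` fixing the normal subextension `F ⊆ K̄` pointwise restricts to the identity
of `F`. [folklore] -/
theorem absRestrictNormalHom_eq_one_of_mem_fixingSubgroup {K : Type u} [Field K]
    (F : IntermediateField K (AlgebraicClosure K)) [Normal K F] {σ : absoluteGaloisGroup K}
    (hσ : σ ∈ (F.fixingSubgroup : Subgroup (absoluteGaloisGroup K))) :
    absRestrictNormalHom F σ = 1 := by
  rw [mem_fixingSubgroup_iff_forall_smul] at hσ
  refine AlgEquiv.ext fun x ↦ Subtype.ext ?_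
  have hcomm := AlgEquiv.restrictNormal_commutes (absoluteGaloisGroup.toAlgEquiv K σ) F x
  change (((absoluteGaloisGroup.toAlgEquiv K σ).restrictNormal F x : F) : AlgebraicClosure K) = x
  exact hcomm.trans (hσ x)

end Literature.NumberTheory.GaloisRepresentations

namespace WeierstrassCurve

open Literature.NumberTheory.EllipticCurves Literature.NumberTheory.GaloisRepresentations
  IsDedekindDomain.HeightOneSpectrum

/-! ### `ρ_{E,ℓ}(τ) = 1` iff `τ` fixes the `ℓ`-power torsion -/

section AnyField

variable {K : Type u} [Field K] (W : WeierstrassCurve K) (ℓ : ℕ) [Fact ℓ.Prime]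

/-- `τ ∈ Γ_K` acts trivially on `T_ℓ E` iff it fixes every `ℓ`-power torsion point of `E(K̄)`
(`T_ℓ E → E[ℓⁿ]` is onto, `proj_surjective_of_isAlgClosed_holds`, Silverman *AEC* III.§7).
[folklore] -/
theorem galoisRepTate_eq_one_iff_forall_smul_torsion_eq [W.IsElliptic] {τ : absoluteGaloisGroup K} :
    W.galoisRepTate ℓ τ = 1 ↔ ∀ (n : ℕ) (P : geomPoints W), ℓ ^ n • P = 0 → τ • P = P := by
  refine ⟨fun hT n P hP ↦ ?_, W.galoisRepTate_eq_one_of_forall_smul_torsion_eq ℓ⟩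
  obtain ⟨a, rfl⟩ := W.proj_surjective_of_isAlgClosed_holds ℓ n (P := P)
    ((Submodule.mem_torsionBy_iff _ _).mpr (by rw [natCast_zsmul, hP]))
  rw [← TateModule.proj_smul_of_distribMulAction, ← galoisRepTate_apply_apply, hT,
    Module.End.one_apply]

/-- `τ ∈ Γ_K` acts trivially on `V_ℓ E` (the representation `rationalTateGaloisRepOf (geomPoints W) ℓ h`
of `HasseWeilAbelian`, definitionally `W.rationalGaloisRepTate ℓ`) iff it fixes every `ℓ`-power
torsion point of `E(K̄)` (`T_ℓ E ↪ V_ℓ E`, `galoisRepTate_eq_one_iff_rationalGaloisRepTate_eq_one`).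
[folklore] -/
theorem rationalTateGaloisRepOf_eq_one_iff_forall_smul_torsion_eq [W.IsElliptic]
    (h : Continuous fun x : absoluteGaloisGroup K × RationalTateModule (geomPoints W) ℓ ↦
      rationalTateRepresentation (absoluteGaloisGroup K) (geomPoints W) ℓ x.1 x.2)
    {τ : absoluteGaloisGroup K} :
    rationalTateGaloisRepOf (geomPoints W) ℓ h τ = 1 ↔
      ∀ (n : ℕ) (P : geomPoints W), ℓ ^ n • P = 0 → τ • P = P := by
  rw [← W.galoisRepTate_eq_one_iff_forall_smul_torsion_eq ℓ,
    W.galoisRepTate_eq_one_iff_rationalGaloisRepTate_eq_one ℓ]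
  rfl

/-- `V_ℓ E` is tame at `𝔓` iff every `Γ_K^u(𝔓)`, `u > 0`, fixes every `ℓ`-power torsion point of
`E(K̄)` (unfolding of `GaloisRep.IsTameAt` through
`rationalTateGaloisRepOf_eq_one_iff_forall_smul_torsion_eq`). [folklore] -/
theorem isTameAt_rationalTate_iff_forall_smul_torsion_eq [W.IsElliptic]
    (h : Continuous fun x : absoluteGaloisGroup K × RationalTateModule (geomPoints W) ℓ ↦
      rationalTateRepresentation (absoluteGaloisGroup K) (geomPoints W) ℓ x.1 x.2)
    (𝔓 : Ideal (absIntegers (𝓞 K) K)) :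
    (rationalTateGaloisRepOf (geomPoints W) ℓ h).IsTameAt (𝓞 K) 𝔓 ↔
      ∀ ⦃u : ℝ⦄, 0 < u → ∀ ⦃σ : absoluteGaloisGroup K⦄, σ ∈ absUpperRamificationSubgroup (𝓞 K) 𝔓 u →
        ∀ (n : ℕ) (P : geomPoints W), ℓ ^ n • P = 0 → σ • P = P := by
  unfold GaloisRep.IsTameAt
  refine forall₂_congr fun u _ ↦ forall₂_congr fun σ _ ↦ ?_
  exact W.rationalTateGaloisRepOf_eq_one_iff_forall_smul_torsion_eq ℓ h

end AnyField

/-! ### `Sw_𝔓(V_ℓ E) = 0` iff `V_ℓ E` is tame at `𝔓` -/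

section SwanZero

variable {K : Type u} [Field K] [NumberField K] (W : WeierstrassCurve K) (ℓ : ℕ) [Fact ℓ.Prime]

/-- **`Sw_𝔓(V_ℓ E) = 0` iff `V_ℓ E` is tame at `𝔓`** (`𝔓 ∣ v ∤ ℓ`).  `⇐` is
`GaloisRep.IsTameAt.swanConductorAt_eq_zero`.  `⇒`: by the book's lower-numbering formula
(`swanConductorAt_rationalTate_eq_finsum_torsion`, Silverman *ATAEC* §IV.10 Definition, PDF
p. 358, over a finite Galois `F/K` through which `E[ℓ]` is defined) `Sw_𝔓(V_ℓ E)` is a finite sum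
of non-negative terms whose `i = 1` term is `(#G_1/#G_0) · codim E[ℓ]^{G_1}`; if the sum vanishes,
`G_1` fixes `E[ℓ]`, and every `Γ_K^u(𝔓)`, `u > 0`, restricts into `Gal(F/K)^u ≤ G_1`
(`mem_absUpperRamificationSubgroup_iff`, `upperRamificationSubgroup_le_ramificationSubgroup_one`,
Serre IV §3), so `E[ℓ]`, hence `V_ℓ E` (`isTameAt_rationalTate_iff_torsion`), is tame at `𝔓`.  This
is the equivalence *"`L/K` is wildly ramified if and only if `G_1(L/K) ≠ 1`"* (ATAEC Lemma
IV.10.1(d)) read through the definition of `δ(E/K)`.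
[cite: SilvermanATAEC1994, §IV.10 Lemma 10.1(d) and Definition of δ(E/K) (PDF p. 358)]
[cite: SerreLocalFields1979, Ch. VI §2 Cor. 1' and Ch. IV §3] -/
theorem swanConductorAt_rationalTate_eq_zero_iff_isTameAt [W.IsElliptic]
    (h : Continuous fun x : absoluteGaloisGroup K × RationalTateModule (geomPoints W) ℓ ↦
      rationalTateRepresentation (absoluteGaloisGroup K) (geomPoints W) ℓ x.1 x.2)
    {v : HeightOneSpectrum (𝓞 K)} (hℓ : (ℓ : 𝓞 K) ∉ v.asIdeal)
    {𝔓 : Ideal (absIntegers (𝓞 K) K)} (h𝔓 : 𝔓 ∈ v.primesAbove) :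
    (rationalTateGaloisRepOf (geomPoints W) ℓ h).swanConductorAt (𝓞 K) 𝔓 = 0 ↔
      (rationalTateGaloisRepOf (geomPoints W) ℓ h).IsTameAt (𝓞 K) 𝔓 := by
  refine ⟨fun h0 ↦ ?_, GaloisRep.IsTameAt.swanConductorAt_eq_zero⟩
  haveI : 𝔓.IsPrime := h𝔓.1
  have hprime : ℓ.Prime := Fact.out
  -- the `ZMod ℓ`-module structure on `E[ℓ]` (Mathlib `AddSubgroup.torsionBy.zmodModule`, the one
  -- underlying `torsionGaloisRep`), activated inside this proof only
  letI : Module (ZMod ℓ) (geomTorsion W ℓ) := AddSubgroup.torsionBy.zmodModule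
  haveI : Finite (geomTorsion W ℓ) := W.finite_geomTorsion_nat hprime.ne_zero
  haveI : Module.Finite (ZMod ℓ) (geomTorsion W ℓ) := Module.Finite.of_finite
  obtain ⟨F, hfin, hgal, hF⟩ := W.exists_isGalois_forall_smul_geomTorsion_eq (m := ℓ) hprime.ne_zero
  haveI := hfin
  haveI := hgal
  set ρ := W.torsionGaloisRep ℓ with hρ
  set G : ℕ → Subgroup (F ≃ₐ[K] F) := fun i ↦
    (𝔓.comap (F.integralClosureToAbsIntegers (𝓞 K))).ramificationSubgroup (F ≃ₐ[K] F) i with hG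
  set t : ℕ → ℝ := fun i ↦ ((Nat.card (G (i + 1)) : ℝ) / Nat.card (G 0)) *
    ρ.codimFixed ((G (i + 1)).comap (absRestrictNormalHom F)) with ht
  have hsum : (rationalTateGaloisRepOf (geomPoints W) ℓ h).swanConductorAt (𝓞 K) 𝔓 =
      ∑ᶠ i : ℕ, t i :=
    W.swanConductorAt_rationalTate_eq_finsum_torsion ℓ h hℓ h𝔓 F hF
  -- the sum is finite and its terms are non-negative, so each term vanishes
  obtain ⟨N, hN⟩ := ramificationSubgroup_comap_eventually_eq_bot (𝓞 K) 𝔓 F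
  have hsupp : (Function.support t).Finite := by
    refine (Set.finite_Iio N).subset fun i hi ↦ ?_
    rw [Function.mem_support] at hi
    rw [Set.mem_Iio]
    by_contra hle
    apply hi
    simp only [ht, hG]
    rw [hN (i + 1) (by omega), MonoidHom.comap_bot,
      ContinuousRep.codimFixed_eq_zero_of_forall_eq_one ρ
        (fun σ hσ ↦ LinearMap.ext fun P ↦ hF σ (MonoidHom.mem_ker.mp hσ) P),
      Nat.cast_zero, mul_zero]
  have hnn : ∀ i, 0 ≤ t i := fun i ↦ by positivity
  have ht0 : t 0 = 0 := by
    have hle : t 0 ≤ ∑ᶠ i : ℕ, t i := single_le_finsum 0 hsupp hnn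
    rw [← hsum, h0] at hle
    exact le_antisymm hle (hnn 0)
  -- hence `G_1` fixes `E[ℓ]`
  have hG0 : (0 : ℝ) < Nat.card (G 0) := by exact_mod_cast (Nat.card_pos (α := G 0))
  have hG1 : (0 : ℝ) < Nat.card (G 1) := by exact_mod_cast (Nat.card_pos (α := G 1))
  have hcodim : ρ.codimFixed ((G 1).comap (absRestrictNormalHom F)) = 0 := by
    simp only [ht, zero_add, mul_eq_zero, div_eq_zero_iff, Nat.cast_eq_zero] at ht0
    rcases ht0 with (h1 | h1) | h1
    · exact absurd h1 (by exact_mod_cast hG1.ne')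
    · exact absurd h1 (by exact_mod_cast hG0.ne')
    · exact h1
  rw [ContinuousRep.codimFixed_eq_zero_iff] at hcodim
  -- and every `Γ_K^u(𝔓)`, `u > 0`, restricts into `G^u ≤ G_1`
  refine (W.isTameAt_rationalTate_iff_torsion ℓ h hℓ h𝔓).mpr fun u hu σ hσ ↦ ?_
  refine hcodim σ (Subgroup.mem_comap.mpr ?_)
  exact upperRamificationSubgroup_le_ramificationSubgroup_one
    (𝔓.comap (F.integralClosureToAbsIntegers (𝓞 K))) (F ≃ₐ[K] F) hu
    ((mem_absUpperRamificationSubgroup_iff.mp hσ) F)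

/-- `Sw_𝔓(V_ℓ E) ≠ 0` iff some wild ramification group `Γ_K^u(𝔓)`, `u > 0`, moves some `ℓ`-power
torsion point (contrapositive unfolding of `swanConductorAt_rationalTate_eq_zero_iff_isTameAt`).
[folklore] -/
theorem swanConductorAt_rationalTate_ne_zero_iff_exists_smul_ne [W.IsElliptic]
    (h : Continuous fun x : absoluteGaloisGroup K × RationalTateModule (geomPoints W) ℓ ↦
      rationalTateRepresentation (absoluteGaloisGroup K) (geomPoints W) ℓ x.1 x.2)
    {v : HeightOneSpectrum (𝓞 K)} (hℓ : (ℓ : 𝓞 K) ∉ v.asIdeal)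
    {𝔓 : Ideal (absIntegers (𝓞 K) K)} (h𝔓 : 𝔓 ∈ v.primesAbove) :
    (rationalTateGaloisRepOf (geomPoints W) ℓ h).swanConductorAt (𝓞 K) 𝔓 ≠ 0 ↔
      ∃ u : ℝ, 0 < u ∧ ∃ σ ∈ absUpperRamificationSubgroup (𝓞 K) 𝔓 u,
        ∃ (n : ℕ) (P : geomPoints W), ℓ ^ n • P = 0 ∧ σ • P ≠ P := by
  rw [Ne, W.swanConductorAt_rationalTate_eq_zero_iff_isTameAt ℓ h hℓ h𝔓,
    W.isTameAt_rationalTate_iff_forall_smul_torsion_eq ℓ h 𝔓]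
  push Not
  rfl

end SwanZero

/-! ### Lemma N: Néron–Ogg–Shafarevich over a finite extension, from the `ℓ`-power torsion -/

section LemmaN

variable {K : Type u} [Field K] [NumberField K] (W : WeierstrassCurve K)
  (L : Type u) [Field L] [NumberField L] [Algebra K L] [Algebra.IsAlgebraic K L]

/-- **Lemma N (Néron–Ogg–Shafarevich over `L`, from one prime `ℓ`).**  Let `E/K` be an elliptic
curve over a number field, `L/K` a finite extension, `N ≤ Γ_K` the image of `Γ_L → Γ_K`
(`absGaloisRestrict`), `v` a finite place, `𝔓 ∣ v` a prime of `\bar ℤ_K` and `ℓ` a prime with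
`v ∤ ℓ`.  If every element of `I_𝔓 ∩ N` fixes every `ℓ`-power torsion point of `E(K̄)`, then every
element of `I_𝔓 ∩ N` fixes every `m`-torsion point for every `m` with `v ∤ m`.  Proof: let `w` be
the place of `L` and `𝔔 ∣ w` the prime of `\bar ℤ_L` cut out by `𝔓`
(`exists_primesAbove_mem_inertia_iff`: `I_𝔔 ↔ I_𝔓 ∩ N`).  Every prime of `\bar ℤ_L` above `w` is
`g • 𝔔`, `g ∈ Γ_L` (`exists_smul_eq_of_mem_primesAbove_holds`), with inertia group `g I_𝔔 g⁻¹`, and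
every `ℓⁿ`-torsion point of `E_L(L̄)` comes from one of `E(K̄)`
(`exists_pointsMapOfEmb_eq_of_nsmul_eq_zero`, equivariantly,
`localPointsEquivGeomPoints_pointsMapOfEmb_smul`); so all inertia groups above `w` fix the `ℓ`-power
torsion of `E_L`, and `E_L` has good reduction at `w` by the criterion of Néron–Ogg–Shafarevich
(Silverman *AEC* Thm. VII.7.1 (d) ⇒ (a), the tree's theorem
`hasGoodReductionAt_of_infinite_unramifiedTorsion_holds` in its global form
`hasGoodReductionAt_of_infinite_unramifiedTorsion_primesAbove`).  Then Prop. VII.4.1(a) for `E_L`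
at `w` (`smul_eq_of_mem_inertia_of_nsmul_eq_zero`), pulled back along `E(K̄) → E_L(L̄)`
(`absGaloisRestrict_smul_eq_iff`), gives the claim.  This is Prop. IV.10.3 of *ATAEC* ((iii) ⇒ (i)
⇒ (ii), PDF p. 360) with the finiteness of the inertia image replaced by the hypothesis on `N`.
[cite: SilvermanAEC2009, Thm. VII.7.1 and Prop. VII.4.1(a)]
[cite: SilvermanATAEC1994, Prop. IV.10.3 (PDF pp. 360–361)] -/
theorem forall_smul_torsion_eq_of_mem_inertia_inf_range [W.IsElliptic]
    {v : HeightOneSpectrum (𝓞 K)} {𝔓 : Ideal (absIntegers (𝓞 K) K)} (h𝔓 : 𝔓 ∈ v.primesAbove)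
    {ℓ : ℕ} [Fact ℓ.Prime] (hℓ : (ℓ : 𝓞 K) ∉ v.asIdeal)
    (hfix : ∀ ⦃τ : absoluteGaloisGroup K⦄, τ ∈ 𝔓.inertia (absoluteGaloisGroup K) →
      τ ∈ (absGaloisRestrict K L).range →
        ∀ (n : ℕ) (P : geomPoints W), ℓ ^ n • P = 0 → τ • P = P)
    {τ : absoluteGaloisGroup K} (hτ : τ ∈ 𝔓.inertia (absoluteGaloisGroup K))
    (hτL : τ ∈ (absGaloisRestrict K L).range)
    {m : ℕ} (hm : (m : 𝓞 K) ∉ v.asIdeal) (P : geomPoints W) (hP : m • P = 0) : τ • P = P := by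
  have hprime : ℓ.Prime := Fact.out
  obtain ⟨w, 𝔔, hw, h𝔔, hI⟩ := exists_primesAbove_mem_inertia_iff K L h𝔓
  haveI : (W.baseChange L).IsElliptic := inferInstanceAs (W.map (algebraMap K L)).IsElliptic
  -- `n ∉ v ⇒ n ∉ w`
  have hmemw : ∀ {n : ℕ}, (n : 𝓞 K) ∉ v.asIdeal → (n : 𝓞 L) ∉ w.asIdeal := by
    intro n hn hmem
    apply hn
    have : (n : 𝓞 L) = algebraMap (𝓞 K) (𝓞 L) n := by simp
    rw [this] at hmem
    rw [← hw, Ideal.under_def, Ideal.mem_comap]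
    exact hmem
  -- Step 1: `E_L` has good reduction at `w`
  have hgood : (W.baseChange L).HasGoodReductionAt w := by
    refine (W.baseChange L).hasGoodReductionAt_of_infinite_unramifiedTorsion_primesAbove
      ((W.baseChange L).hasGoodReductionAt_of_infinite_unramifiedTorsion_holds) w
      ((Set.infinite_range_of_injective (Nat.pow_right_injective hprime.two_le)).mono ?_)
    rintro _ ⟨n, rfl⟩
    refine ⟨hmemw (v.natCast_pow_not_mem hℓ n), fun 𝔔' h𝔔' γ hγ Q hQ ↦ ?_⟩
    -- move to the prime `𝔔`
    obtain ⟨g, rfl⟩ := HeightOneSpectrum.exists_smul_eq_of_mem_primesAbove_holds h𝔔 h𝔔'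
    rw [mem_inertia_smul_iff_conj_mem] at hγ
    have hγ' : γ = g * (g⁻¹ * γ * g) * g⁻¹ := by group
    rw [hγ']
    refine forall_smul_eq_of_nsmul_eq_zero_conj (fun Q hQ ↦ ?_) g Q hQ
    -- every `ℓⁿ`-torsion point of `E_L(L̄)` comes from `E(K̄)`
    obtain ⟨Q₀, rfl⟩ := (localPointsEquivGeomPoints W L).surjective Q
    have hQ₀ : (ℓ ^ n) • Q₀ = 0 := by
      apply (localPointsEquivGeomPoints W L).injective
      rw [map_nsmul, hQ, map_zero]
    obtain ⟨R, hR, rfl⟩ := exists_pointsMapOfEmb_eq_of_nsmul_eq_zero W (absClosureEmbedding K L)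
      (pow_ne_zero n hprime.ne_zero) hQ₀
    rw [← localPointsEquivGeomPoints_pointsMapOfEmb_smul,
      hfix ((hI _).mp hγ) ⟨_, rfl⟩ n R hR]
  -- Step 2: *AEC* VII.4.1(a) for `E_L` at `w`, pulled back
  obtain ⟨γ, rfl⟩ := hτL
  change absGaloisRestrict K L γ ∈ _ at hτ
  change absGaloisRestrict K L γ • P = P
  have hγ : γ ∈ 𝔔.inertia (absoluteGaloisGroup L) := (hI γ).mpr hτ
  rw [absGaloisRestrict_smul_eq_iff]
  refine (W.baseChange L).smul_eq_of_mem_inertia_of_nsmul_eq_zero hgood (hmemw hm) h𝔔 hγ ?_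
  rw [← map_nsmul, ← map_nsmul, hP, map_zero, map_zero]

end LemmaN

/-! ### The wild kernel at a place of potentially good reduction does not depend on `ℓ` -/

section PotentiallyGood

variable {K : Type u} [Field K] [NumberField K] (W : WeierstrassCurve K)

/-- **The kernel of the inertia action on `T_ℓ E` at a place of potentially good reduction does
not depend on `ℓ`** (Serre–Tate 1968, §§1–2; Silverman *ATAEC*
Prop. IV.10.3 and the step *"all of the `L_m`'s are the same"* of the proof of Thm. IV.10.2(b), PDF
p. 361).  Let `E/K` be an elliptic curve over a number field, `v` a finite place, `𝔓 ∣ v`, and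
suppose potential good reduction at `v` in Galois form (`hpot`): a finite normal `F/K` inside `K̄`
such that every `σ ∈ I_𝔓` with `σ|_F = 1` fixes every `m'`-torsion point, `v ∤ m'` (the shape of
`exists_normal_smul_torsion_eq_self_of_valuation_j_le_one_of_notMem`).  If `τ ∈ I_𝔓` fixes every
`ℓ`-power torsion point for one prime `ℓ` with `v ∤ ℓ`, then `τ` fixes every `m`-torsion point for
every `m` with `v ∤ m`.  Proof: Lemma N (`forall_smul_torsion_eq_of_mem_inertia_inf_range`) for the
fixed field `L` of the open subgroup `H = {σ : σ|_F ∈ ⟨τ|_F⟩}`, whose image `Γ_L → Γ_K` is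
`g H g⁻¹` (`exists_mem_range_absGaloisRestrict_fixedField_iff`), at the prime `g • 𝔓` and the
element `g τ g⁻¹`: an element `σ'` of `I_𝔓 ∩ H` is `(σ' τ^{-k}) τ^k` with `σ' τ^{-k} ∈ I_𝔓` fixing
`F`, so `I_𝔓 ∩ H`, hence `I_{g𝔓} ∩ gHg⁻¹`, fixes the `ℓ`-power torsion.
[cite: SerreTate1968, §1 (Thm. 1) and §2]
[cite: SilvermanATAEC1994, Prop. IV.10.3 and proof of Thm. IV.10.2(b) (PDF pp. 360–361)] -/
theorem forall_smul_torsion_eq_of_forall_smul_torsion_eq_of_potentiallyGood [W.IsElliptic]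
    {v : HeightOneSpectrum (𝓞 K)} {𝔓 : Ideal (absIntegers (𝓞 K) K)} (h𝔓 : 𝔓 ∈ v.primesAbove)
    (hpot : ∃ (F : IntermediateField K (AlgebraicClosure K)) (_ : FiniteDimensional K F)
      (_ : Normal K F),
      ∀ {σ : absoluteGaloisGroup K} (_hσI : σ ∈ 𝔓.inertia (absoluteGaloisGroup K))
        (_hσF : σ ∈ (absRestrictNormalHom F).ker)
        {m' : ℕ} (_hm' : (m' : 𝓞 K) ∉ v.asIdeal) (P : geomPoints W), m' • P = 0 → σ • P = P)
    {ℓ : ℕ} [Fact ℓ.Prime] (hℓ : (ℓ : 𝓞 K) ∉ v.asIdeal)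
    {τ : absoluteGaloisGroup K} (hτ : τ ∈ 𝔓.inertia (absoluteGaloisGroup K))
    (hτℓ : ∀ (n : ℕ) (P : geomPoints W), ℓ ^ n • P = 0 → τ • P = P)
    {m : ℕ} (hm : (m : 𝓞 K) ∉ v.asIdeal) (P : geomPoints W) (hP : m • P = 0) : τ • P = P := by
  obtain ⟨F, hfin, hnorm, hF⟩ := hpot
  haveI := hfin
  haveI := hnorm
  -- the open subgroup `H = {σ : σ|_F ∈ ⟨τ|_F⟩}`
  set H : Subgroup (absoluteGaloisGroup K) :=
    (Subgroup.zpowers (absRestrictNormalHom F τ)).comap (absRestrictNormalHom F) with hH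
  have hτH : τ ∈ H := Subgroup.mem_comap.mpr (Subgroup.mem_zpowers _)
  have hkerH : (absRestrictNormalHom F).ker ≤ H := fun σ hσ ↦ by
    rw [hH, Subgroup.mem_comap, (MonoidHom.mem_ker).mp hσ]
    exact one_mem _
  have hFixle : (F.fixingSubgroup : Subgroup (absoluteGaloisGroup K)) ≤ (absRestrictNormalHom F).ker :=
    fun σ hσ ↦ (MonoidHom.mem_ker).mpr (absRestrictNormalHom_eq_one_of_mem_fixingSubgroup F hσ)
  have hHopen : IsOpen ((H : Subgroup (absoluteGaloisGroup K)) : Set (absoluteGaloisGroup K)) :=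
    Subgroup.isOpen_mono (H₁ := F.fixingSubgroup) (hFixle.trans hkerH) F.fixingSubgroup_isOpen
  -- every element of `I_𝔓 ∩ H` fixes the `ℓ`-power torsion
  have key : ∀ σ' ∈ 𝔓.inertia (absoluteGaloisGroup K), σ' ∈ H →
      ∀ (n : ℕ) (P : geomPoints W), ℓ ^ n • P = 0 → σ' • P = P := by
    intro σ' hσ'I hσ'H n P hP
    obtain ⟨k, hk⟩ := Subgroup.mem_zpowers_iff.mp (Subgroup.mem_comap.mp hσ'H)
    have hker : σ' * (τ ^ k)⁻¹ ∈ (absRestrictNormalHom F).ker := by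
      rw [MonoidHom.mem_ker, map_mul, map_inv, map_zpow, hk, mul_inv_cancel]
    have hI' : σ' * (τ ^ k)⁻¹ ∈ 𝔓.inertia (absoluteGaloisGroup K) :=
      mul_mem hσ'I (inv_mem (zpow_mem hτ k))
    have hτk : τ ^ k • P = P :=
      MulAction.mem_fixedBy_zpow (show P ∈ MulAction.fixedBy (geomPoints W) τ from hτℓ n P hP) k
    have hPk : ℓ ^ n • (τ ^ k • P) = 0 := by rw [smul_comm, hP, smul_zero]
    calc σ' • P = (σ' * (τ ^ k)⁻¹ * τ ^ k) • P := by rw [inv_mul_cancel_right]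
      _ = (σ' * (τ ^ k)⁻¹) • (τ ^ k • P) := mul_smul _ _ _
      _ = τ ^ k • P := hF hI' hker (v.natCast_pow_not_mem hℓ n) _ hPk
      _ = P := hτk
  -- the fixed field `L` of `H`; the image of `Γ_L → Γ_K` is `g H g⁻¹`
  let L : IntermediateField K (AlgebraicClosure K) := IntermediateField.fixedField H
  haveI : FiniteDimensional K L := finiteDimensional_fixedField_of_isOpen H hHopen
  haveI : NumberField L := NumberField.of_module_finite K L
  obtain ⟨g, hg⟩ := exists_mem_range_absGaloisRestrict_fixedField_iff H hHopen
  -- Lemma N at the prime `g • 𝔓` for the element `g τ g⁻¹`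
  have h𝔓g : g • 𝔓 ∈ v.primesAbove := smul_mem_primesAbove h𝔓 g
  have hτg : g * τ * g⁻¹ ∈ (g • 𝔓).inertia (absoluteGaloisGroup K) := by
    rw [mem_inertia_smul_iff_conj_mem]
    rwa [show g⁻¹ * (g * τ * g⁻¹) * g = τ by group]
  have hτgL : g * τ * g⁻¹ ∈ (absGaloisRestrict K L).range := by
    rw [hg]
    rwa [show g⁻¹ * (g * τ * g⁻¹) * g = τ by group]
  have hfixg : ∀ ⦃σ : absoluteGaloisGroup K⦄, σ ∈ (g • 𝔓).inertia (absoluteGaloisGroup K) →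
      σ ∈ (absGaloisRestrict K L).range →
        ∀ (n : ℕ) (P : geomPoints W), ℓ ^ n • P = 0 → σ • P = P := by
    intro σ hσI hσr n P hP
    have hσ' : g⁻¹ * σ * g ∈ 𝔓.inertia (absoluteGaloisGroup K) :=
      (mem_inertia_smul_iff_conj_mem g σ 𝔓).mp hσI
    have hσH : g⁻¹ * σ * g ∈ H := (hg σ).mp hσr
    have := forall_smul_eq_of_nsmul_eq_zero_conj (key _ hσ' hσH n) g P hP
    rwa [show g * (g⁻¹ * σ * g) * g⁻¹ = σ by group] at this
  have hconj : ∀ Q : geomPoints W, m • Q = 0 → (g * τ * g⁻¹) • Q = Q := fun Q hQ ↦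
    W.forall_smul_torsion_eq_of_mem_inertia_inf_range L h𝔓g hℓ hfixg hτg hτgL hm Q hQ
  have := forall_smul_eq_of_nsmul_eq_zero_conj hconj g⁻¹ P hP
  rwa [show g⁻¹ * (g * τ * g⁻¹) * g⁻¹⁻¹ = τ by group] at this

/-- **Iff form**: at a place of potentially good reduction (Galois form `hpot`), an element of
`I_𝔓` fixes the `ℓ`-power torsion iff it fixes the `ℓ'`-power torsion (`v ∤ ℓ, ℓ'`).
[cite: SerreTate1968, §§1–2] -/
theorem forall_smul_torsion_eq_iff_of_potentiallyGood [W.IsElliptic]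
    {v : HeightOneSpectrum (𝓞 K)} {𝔓 : Ideal (absIntegers (𝓞 K) K)} (h𝔓 : 𝔓 ∈ v.primesAbove)
    (hpot : ∃ (F : IntermediateField K (AlgebraicClosure K)) (_ : FiniteDimensional K F)
      (_ : Normal K F),
      ∀ {σ : absoluteGaloisGroup K} (_hσI : σ ∈ 𝔓.inertia (absoluteGaloisGroup K))
        (_hσF : σ ∈ (absRestrictNormalHom F).ker)
        {m' : ℕ} (_hm' : (m' : 𝓞 K) ∉ v.asIdeal) (P : geomPoints W), m' • P = 0 → σ • P = P)
    {ℓ : ℕ} [Fact ℓ.Prime] (hℓ : (ℓ : 𝓞 K) ∉ v.asIdeal)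
    {ℓ' : ℕ} [Fact ℓ'.Prime] (hℓ' : (ℓ' : 𝓞 K) ∉ v.asIdeal)
    {τ : absoluteGaloisGroup K} (hτ : τ ∈ 𝔓.inertia (absoluteGaloisGroup K)) :
    (∀ (n : ℕ) (P : geomPoints W), ℓ ^ n • P = 0 → τ • P = P) ↔
      ∀ (n : ℕ) (P : geomPoints W), ℓ' ^ n • P = 0 → τ • P = P :=
  ⟨fun h n P hP ↦ W.forall_smul_torsion_eq_of_forall_smul_torsion_eq_of_potentiallyGood h𝔓 hpot
      hℓ hτ h (v.natCast_pow_not_mem hℓ' n) P hP,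
    fun h n P hP ↦ W.forall_smul_torsion_eq_of_forall_smul_torsion_eq_of_potentiallyGood h𝔓 hpot
      hℓ' hτ h (v.natCast_pow_not_mem hℓ n) P hP⟩

/-- **`ρ_{E,ℓ}(τ) = 1 ↔ ρ_{E,ℓ'}(τ) = 1` for `τ ∈ I_𝔓`** at a place of potentially good reduction
(Galois form `hpot`), `v ∤ ℓ, ℓ'`: the kernel of the inertia action on the Tate module does not
depend on `ℓ` (Serre–Tate 1968 §2). [cite: SerreTate1968, §§1–2] -/
theorem galoisRepTate_eq_one_iff_of_potentiallyGood [W.IsElliptic]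
    {v : HeightOneSpectrum (𝓞 K)} {𝔓 : Ideal (absIntegers (𝓞 K) K)} (h𝔓 : 𝔓 ∈ v.primesAbove)
    (hpot : ∃ (F : IntermediateField K (AlgebraicClosure K)) (_ : FiniteDimensional K F)
      (_ : Normal K F),
      ∀ {σ : absoluteGaloisGroup K} (_hσI : σ ∈ 𝔓.inertia (absoluteGaloisGroup K))
        (_hσF : σ ∈ (absRestrictNormalHom F).ker)
        {m' : ℕ} (_hm' : (m' : 𝓞 K) ∉ v.asIdeal) (P : geomPoints W), m' • P = 0 → σ • P = P)
    (ℓ : ℕ) [Fact ℓ.Prime] (hℓ : (ℓ : 𝓞 K) ∉ v.asIdeal)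
    (ℓ' : ℕ) [Fact ℓ'.Prime] (hℓ' : (ℓ' : 𝓞 K) ∉ v.asIdeal)
    {τ : absoluteGaloisGroup K} (hτ : τ ∈ 𝔓.inertia (absoluteGaloisGroup K)) :
    W.galoisRepTate ℓ τ = 1 ↔ W.galoisRepTate ℓ' τ = 1 := by
  rw [W.galoisRepTate_eq_one_iff_forall_smul_torsion_eq ℓ,
    W.galoisRepTate_eq_one_iff_forall_smul_torsion_eq ℓ']
  exact W.forall_smul_torsion_eq_iff_of_potentiallyGood h𝔓 hpot hℓ hℓ' hτ

/-- **`V_ℓ E` is tame at `𝔓` iff `V_{ℓ'} E` is, at a place of potentially good reduction**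
(Galois form `hpot`; `𝔓 ∣ v ∤ ℓ ℓ'`): the wild ramification groups `Γ_K^u(𝔓)`, `u > 0`, lie in
`I_𝔓` (`absUpperRamificationSubgroup_le_inertia_holds`) and, by
`forall_smul_torsion_eq_iff_of_potentiallyGood`, fix the `ℓ`-power torsion iff they fix the
`ℓ'`-power torsion.  Silverman *ATAEC*, proof of Thm. IV.10.2(b): tameness of `E` at `v` is read
off the single field `L = L_m` over which `E` acquires good reduction (PDF p. 361); Serre–Tate §3
(the conductor of the `ℓ`-adic representation for potential good reduction).
[cite: SerreTate1968, §§2–3]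
[cite: SilvermanATAEC1994, proof of Thm. IV.10.2(b) (PDF pp. 360–362)] -/
theorem isTameAt_rationalTate_iff_of_potentiallyGood [W.IsElliptic]
    {v : HeightOneSpectrum (𝓞 K)} {𝔓 : Ideal (absIntegers (𝓞 K) K)} (h𝔓 : 𝔓 ∈ v.primesAbove)
    (hpot : ∃ (F : IntermediateField K (AlgebraicClosure K)) (_ : FiniteDimensional K F)
      (_ : Normal K F),
      ∀ {σ : absoluteGaloisGroup K} (_hσI : σ ∈ 𝔓.inertia (absoluteGaloisGroup K))
        (_hσF : σ ∈ (absRestrictNormalHom F).ker)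
        {m' : ℕ} (_hm' : (m' : 𝓞 K) ∉ v.asIdeal) (P : geomPoints W), m' • P = 0 → σ • P = P)
    (ℓ : ℕ) [Fact ℓ.Prime] (hℓ : (ℓ : 𝓞 K) ∉ v.asIdeal)
    (h : Continuous fun x : absoluteGaloisGroup K × RationalTateModule (geomPoints W) ℓ ↦
      rationalTateRepresentation (absoluteGaloisGroup K) (geomPoints W) ℓ x.1 x.2)
    (ℓ' : ℕ) [Fact ℓ'.Prime] (hℓ' : (ℓ' : 𝓞 K) ∉ v.asIdeal)
    (h' : Continuous fun x : absoluteGaloisGroup K × RationalTateModule (geomPoints W) ℓ' ↦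
      rationalTateRepresentation (absoluteGaloisGroup K) (geomPoints W) ℓ' x.1 x.2) :
    (rationalTateGaloisRepOf (geomPoints W) ℓ h).IsTameAt (𝓞 K) 𝔓 ↔
      (rationalTateGaloisRepOf (geomPoints W) ℓ' h').IsTameAt (𝓞 K) 𝔓 := by
  rw [W.isTameAt_rationalTate_iff_forall_smul_torsion_eq ℓ h 𝔓,
    W.isTameAt_rationalTate_iff_forall_smul_torsion_eq ℓ' h' 𝔓]
  refine forall₂_congr fun u _ ↦ forall₂_congr fun σ hσ ↦ ?_
  exact W.forall_smul_torsion_eq_iff_of_potentiallyGood h𝔓 hpot hℓ hℓ'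
    (absUpperRamificationSubgroup_le_inertia_holds (𝓞 K) 𝔓 u hσ)

/-- **`Sw_𝔓(V_ℓ E) = 0 ↔ Sw_𝔓(V_{ℓ'} E) = 0` at a place of potentially good reduction** (Galois
form `hpot`; `𝔓 ∣ v ∤ ℓ ℓ'`): `isTameAt_rationalTate_iff_of_potentiallyGood` with
`swanConductorAt_rationalTate_eq_zero_iff_isTameAt`.  This is the part of Silverman *ATAEC*
Thm. IV.10.2(c) (independence of `ℓ`) that the zero form of Ogg's formula needs.
[cite: SilvermanATAEC1994, Thm. IV.10.2(c) (PDF p. 358)] [cite: SerreTate1968, §3] -/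
theorem swanConductorAt_rationalTate_eq_zero_iff_of_potentiallyGood [W.IsElliptic]
    {v : HeightOneSpectrum (𝓞 K)} {𝔓 : Ideal (absIntegers (𝓞 K) K)} (h𝔓 : 𝔓 ∈ v.primesAbove)
    (hpot : ∃ (F : IntermediateField K (AlgebraicClosure K)) (_ : FiniteDimensional K F)
      (_ : Normal K F),
      ∀ {σ : absoluteGaloisGroup K} (_hσI : σ ∈ 𝔓.inertia (absoluteGaloisGroup K))
        (_hσF : σ ∈ (absRestrictNormalHom F).ker)
        {m' : ℕ} (_hm' : (m' : 𝓞 K) ∉ v.asIdeal) (P : geomPoints W), m' • P = 0 → σ • P = P)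
    (ℓ : ℕ) [Fact ℓ.Prime] (hℓ : (ℓ : 𝓞 K) ∉ v.asIdeal)
    (h : Continuous fun x : absoluteGaloisGroup K × RationalTateModule (geomPoints W) ℓ ↦
      rationalTateRepresentation (absoluteGaloisGroup K) (geomPoints W) ℓ x.1 x.2)
    (ℓ' : ℕ) [Fact ℓ'.Prime] (hℓ' : (ℓ' : 𝓞 K) ∉ v.asIdeal)
    (h' : Continuous fun x : absoluteGaloisGroup K × RationalTateModule (geomPoints W) ℓ' ↦
      rationalTateRepresentation (absoluteGaloisGroup K) (geomPoints W) ℓ' x.1 x.2) :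
    (rationalTateGaloisRepOf (geomPoints W) ℓ h).swanConductorAt (𝓞 K) 𝔓 = 0 ↔
      (rationalTateGaloisRepOf (geomPoints W) ℓ' h').swanConductorAt (𝓞 K) 𝔓 = 0 := by
  rw [W.swanConductorAt_rationalTate_eq_zero_iff_isTameAt ℓ h hℓ h𝔓,
    W.swanConductorAt_rationalTate_eq_zero_iff_isTameAt ℓ' h' hℓ' h𝔓]
  exact W.isTameAt_rationalTate_iff_of_potentiallyGood h𝔓 hpot ℓ hℓ h ℓ' hℓ' h'

/-! ### Unconditionally at the places `v ∤ 6` of integral `j` -/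

/-- **At a place `v ∤ 6` with `ord_v(j) ≥ 0`, `V_ℓ E` is tame at `𝔓 ∣ v` iff `V_{ℓ'} E` is**
(`v ∤ ℓ, ℓ'`), unconditionally: potential good reduction in Galois form is the theorem
`exists_normal_smul_torsion_eq_self_of_valuation_j_le_one_of_notMem`
(`HasseWeilAbelianPotentialGoodReductionProofs`, good reduction over `K(¹²√Δ)`).  (At such places
both sides in fact hold, `isTameAt_rationalTate_of_valuation_j_le_one`; recorded as the first
unconditional instance of `isTameAt_rationalTate_iff_of_potentiallyGood`.)
[cite: SilvermanATAEC1994, Thm. IV.10.2(b),(c) (PDF p. 358)] -/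
theorem isTameAt_rationalTate_iff_of_notMem [W.IsElliptic]
    {v : HeightOneSpectrum (𝓞 K)} (hj : v.valuation K W.j ≤ 1)
    (h2 : (2 : 𝓞 K) ∉ v.asIdeal) (h3 : (3 : 𝓞 K) ∉ v.asIdeal)
    {𝔓 : Ideal (absIntegers (𝓞 K) K)} (h𝔓 : 𝔓 ∈ v.primesAbove)
    (ℓ : ℕ) [Fact ℓ.Prime] (hℓ : (ℓ : 𝓞 K) ∉ v.asIdeal)
    (h : Continuous fun x : absoluteGaloisGroup K × RationalTateModule (geomPoints W) ℓ ↦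
      rationalTateRepresentation (absoluteGaloisGroup K) (geomPoints W) ℓ x.1 x.2)
    (ℓ' : ℕ) [Fact ℓ'.Prime] (hℓ' : (ℓ' : 𝓞 K) ∉ v.asIdeal)
    (h' : Continuous fun x : absoluteGaloisGroup K × RationalTateModule (geomPoints W) ℓ' ↦
      rationalTateRepresentation (absoluteGaloisGroup K) (geomPoints W) ℓ' x.1 x.2) :
    (rationalTateGaloisRepOf (geomPoints W) ℓ h).IsTameAt (𝓞 K) 𝔓 ↔
      (rationalTateGaloisRepOf (geomPoints W) ℓ' h').IsTameAt (𝓞 K) 𝔓 := by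
  obtain ⟨F, hF, hN, hpot⟩ :=
    W.exists_normal_smul_torsion_eq_self_of_valuation_j_le_one_of_notMem v hj h2 h3 h𝔓
  exact W.isTameAt_rationalTate_iff_of_potentiallyGood h𝔓 ⟨F, hF, hN, hpot⟩ ℓ hℓ h ℓ' hℓ' h'

/-- **At a place `v ∤ 2` with `ord_v(j) ≥ 0` — in particular at residue characteristic `3` —
`V_ℓ E` is tame at `𝔓 ∣ v` iff `V_{ℓ'} E` is** (`v ∤ ℓ, ℓ'`), unconditionally: potential good
reduction in Galois form at `v ∤ 2` is the theorem
`exists_normal_smul_torsion_eq_self_of_valuation_j_le_one_of_notMem_two`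
(`PotentialGoodReductionOddProofs`, good reduction over `F ⊇ K(E[4])`, *ATAEC* Prop. IV.10.3(b)).
This is the instance used for CDT Thm. 7.2.4 (`K = ℚ`, `v = 3`, `ℓ = 2`, `ℓ' = 5`).
[cite: SerreTate1968, §§2–3]
[cite: SilvermanATAEC1994, Prop. IV.10.3 and proof of Thm. IV.10.2(b),(c) (PDF pp. 360–362)] -/
theorem isTameAt_rationalTate_iff_of_valuation_j_le_one_of_notMem_two [W.IsElliptic]
    {v : HeightOneSpectrum (𝓞 K)} (hj : v.valuation K W.j ≤ 1) (h2 : (2 : 𝓞 K) ∉ v.asIdeal)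
    {𝔓 : Ideal (absIntegers (𝓞 K) K)} (h𝔓 : 𝔓 ∈ v.primesAbove)
    (ℓ : ℕ) [Fact ℓ.Prime] (hℓ : (ℓ : 𝓞 K) ∉ v.asIdeal)
    (h : Continuous fun x : absoluteGaloisGroup K × RationalTateModule (geomPoints W) ℓ ↦
      rationalTateRepresentation (absoluteGaloisGroup K) (geomPoints W) ℓ x.1 x.2)
    (ℓ' : ℕ) [Fact ℓ'.Prime] (hℓ' : (ℓ' : 𝓞 K) ∉ v.asIdeal)
    (h' : Continuous fun x : absoluteGaloisGroup K × RationalTateModule (geomPoints W) ℓ' ↦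
      rationalTateRepresentation (absoluteGaloisGroup K) (geomPoints W) ℓ' x.1 x.2) :
    (rationalTateGaloisRepOf (geomPoints W) ℓ h).IsTameAt (𝓞 K) 𝔓 ↔
      (rationalTateGaloisRepOf (geomPoints W) ℓ' h').IsTameAt (𝓞 K) 𝔓 := by
  obtain ⟨F, hF, hN, hpot⟩ :=
    W.exists_normal_smul_torsion_eq_self_of_valuation_j_le_one_of_notMem_two v hj h2 h𝔓
  exact W.isTameAt_rationalTate_iff_of_potentiallyGood h𝔓 ⟨F, hF, hN, hpot⟩ ℓ hℓ h ℓ' hℓ' h'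

/-- **`Sw_𝔓(V_ℓ E) = 0 ↔ Sw_𝔓(V_{ℓ'} E) = 0` at a place `v ∤ 2` of integral `j`** (`v ∤ ℓ, ℓ'`),
unconditionally (`isTameAt_rationalTate_iff_of_valuation_j_le_one_of_notMem_two` with
`swanConductorAt_rationalTate_eq_zero_iff_isTameAt`): the part of Silverman *ATAEC* Thm. IV.10.2(c)
needed by the zero form of Ogg's formula at `p = 3` at the places of potentially good reduction.
[cite: SilvermanATAEC1994, Thm. IV.10.2(c) (PDF p. 358)] [cite: SerreTate1968, §3] -/
theorem swanConductorAt_rationalTate_eq_zero_iff_of_valuation_j_le_one_of_notMem_two [W.IsElliptic]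
    {v : HeightOneSpectrum (𝓞 K)} (hj : v.valuation K W.j ≤ 1) (h2 : (2 : 𝓞 K) ∉ v.asIdeal)
    {𝔓 : Ideal (absIntegers (𝓞 K) K)} (h𝔓 : 𝔓 ∈ v.primesAbove)
    (ℓ : ℕ) [Fact ℓ.Prime] (hℓ : (ℓ : 𝓞 K) ∉ v.asIdeal)
    (h : Continuous fun x : absoluteGaloisGroup K × RationalTateModule (geomPoints W) ℓ ↦
      rationalTateRepresentation (absoluteGaloisGroup K) (geomPoints W) ℓ x.1 x.2)
    (ℓ' : ℕ) [Fact ℓ'.Prime] (hℓ' : (ℓ' : 𝓞 K) ∉ v.asIdeal)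
    (h' : Continuous fun x : absoluteGaloisGroup K × RationalTateModule (geomPoints W) ℓ' ↦
      rationalTateRepresentation (absoluteGaloisGroup K) (geomPoints W) ℓ' x.1 x.2) :
    (rationalTateGaloisRepOf (geomPoints W) ℓ h).swanConductorAt (𝓞 K) 𝔓 = 0 ↔
      (rationalTateGaloisRepOf (geomPoints W) ℓ' h').swanConductorAt (𝓞 K) 𝔓 = 0 := by
  rw [W.swanConductorAt_rationalTate_eq_zero_iff_isTameAt ℓ h hℓ h𝔓,
    W.swanConductorAt_rationalTate_eq_zero_iff_isTameAt ℓ' h' hℓ' h𝔓]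
  exact W.isTameAt_rationalTate_iff_of_valuation_j_le_one_of_notMem_two hj h2 h𝔓 ℓ hℓ h ℓ' hℓ' h'

end PotentiallyGood


end WeierstrassCurve

end
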